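import Summits.CriticalPhenomena.Ising3DConformalLimit.Theorems.PrecisionLaplacianMoebiusLimitOfTwoPointLawMultipoleEdge
import Summits.CriticalPhenomena.Ising3DConformalLimit.Theorems.PrecisionLaplacianMoebiusLimitOfTwoPointLawWardToMoebius
import Summits.CriticalPhenomena.Ising3DConformalLimit.Theorems.PrimaryAtInfinityMultipoleToWard
import Summits.CriticalPhenomena.Ising3DConformalLimit.Theorems.PrecisionLaplacianMoebiusLimitOfTwoPointLawRegularOfLimitExists
import Summits.CriticalPhenomena.Ising3DConformalLimit.Theses.IsingEuclidUpgrade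
import HarnessLib

/-!
# Crux `MoebiusLimitOfTwoPointLaw` (item stmt-CriticalPhenomena-4801) from BARE existence and the two Ward-content items
# (line `multipole-ward-nonsat-endpoint`, skeleton v3, lead c2; `--supports stmt-CriticalPhenomena-4801`)

The line's dependency edge with the minimal existence hypothesis: item stmt-CriticalPhenomena-4738 `WeylWindow.LimitExists`
(bare existence of a non-degenerate pointwise scaling limit of `criticalCorr 3`) replaces item 5355 `ExistsRegularLimit`
(`stub_regularOfLimitExists`, p115643: the regularity package is free) and item 1342 `NonSaturation` is not needed
(`moebiusLimitOfTwoPointLaw_of_primaryAtInfinity_sharp`, p101387); the analysis items 5356/5357 are the landed theorems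
`Theorems.multipoleToWard_proof` / `wardToMoebius`. So

* `moebiusLimitOfTwoPointLaw_of_limitExists : LimitExists → FirstMultipoleIdentity → FarFieldClustering → crux`, and
* `limitExists_of_moebiusLimitOfTwoPointLaw : crux → IsingEuclidUpgradeR2RotInvPowerLaw → LimitExists` — the existence
  hypothesis is NECESSARY given the crux's own hypothesis (item 0634), so only 5352/5353 can carry surplus.

No definitions, no `sorry`.
-/

noncomputable section

namespace Summit.CriticalPhenomena.Ising3DConformalLimit.PrecisionLaplacianMoebiusLimitOfTwoPointLaw

open Summit.CriticalPhenomena.Ising3DConformalLimit.Theses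

/-- **Crux 4801 from items 4738, 5352, 5353** (`WeylWindow.LimitExists → PrimaryAtInfinity.FirstMultipoleIdentity →
PrimaryAtInfinity.FarFieldClustering → PrecisionLaplacian.MoebiusLimitOfTwoPointLaw`): bare existence is upgraded to a
regular limit for free (`stub_regularOfLimitExists`), then the landed sharp edge of the line with its two analysis items
discharged. [cite: DuminilCopinICM2022, §8.4 p. 29] -/
theorem moebiusLimitOfTwoPointLaw_of_limitExists :
    WeylWindow.LimitExists → PrimaryAtInfinity.FirstMultipoleIdentity → PrimaryAtInfinity.FarFieldClustering →
      PrecisionLaplacian.MoebiusLimitOfTwoPointLaw :=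
  fun hL hM1 hFC =>
    moebiusLimitOfTwoPointLaw_of_primaryAtInfinity_sharp (stub_regularOfLimitExists hL) hM1 hFC
      Summit.CriticalPhenomena.Ising3DConformalLimit.Theorems.multipoleToWard_proof wardToMoebius

/-- The same under the second host route's spelling (`BernsteinTemperature.MoebiusLimitOfTwoPointLaw`).
[cite: DuminilCopinICM2022, §8.4 p. 29] -/
theorem moebiusLimitOfTwoPointLaw_of_limitExists' :
    WeylWindow.LimitExists → PrimaryAtInfinity.FirstMultipoleIdentity → PrimaryAtInfinity.FarFieldClustering →
      BernsteinTemperature.MoebiusLimitOfTwoPointLaw :=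
  moebiusLimitOfTwoPointLaw_of_limitExists

/-- **The existence hypothesis is necessary**: under item 0634 the crux returns item 4738 (forget `Δ` and the Möbius
covariance of the witness). [folklore] -/
theorem limitExists_of_moebiusLimitOfTwoPointLaw (h : PrecisionLaplacian.MoebiusLimitOfTwoPointLaw)
    (hP : IsingEuclidUpgrade.IsingEuclidUpgradeR2RotInvPowerLaw) : WeylWindow.LimitExists := by
  obtain ⟨ρ, _, S, hρ, _, hlim, hnd, _⟩ := h hP
  exact ⟨ρ, S, hρ, hlim, hnd⟩

end Summit.CriticalPhenomena.Ising3DConformalLimit.PrecisionLaplacianMoebiusLimitOfTwoPointLaw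

end
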